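import Summits.ValiantsHypothesis.ValiantsHypothesis.Theorems.LacunarySymmetroidMatrixDescartesCensusLogSqTransfer

/-!
# `MatrixDescartes` — the exchange rate against the WITNESS RATE: with a rate-`r` witness, a saving `b/a < r` closes the route

CONDITIONAL (twice): proves no part of MatrixDescartes; BOTH hypotheses — a real family with VNP complexification and
`2^(r·n⌊log₂n⌋) − 1` real zeros on a monomial curve (for `r = 1` this is the route's PROVED `thetaWitness_proof`; for
`r ≥ 2` an OPEN construction), and the ratio bound `Z^a ≤ 2^(b·K⌊log₂K⌋)` with `b < r·a` (OPEN, ≥ summit-hard) — are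
assumptions; ROUTE-DESIGN DATUM: the lower edge of the window where the crux binds is an artefact of the witness rate.

HONEST FRAMING.  Object-search cell `pub-symmetroid`, crux `Theses.LacunarySymmetroid.MatrixDescartes`
(ledger item `stmt-ValiantsHypothesis-18050`, route `LacunarySymmetroid`; seat `val-sym-mdr-p1`).  Companion of
`…CensusRatioCloses`, `…CensusRatioWindow`, `…CensusLogSqTransfer`.  The deciding argument `closes` pits the crux
against the route's witness `ThetaWitness` (rate `2^(n⌊log₂n⌋)` at `K = n+1` terms: `log₂ Z ≈ 1·K log₂ K`).  This file
isolates the dependence on that rate: `valiant_of_witnessRate_ratio_logSq_io (r a b)`, for ANY `r ≥ 1` and `b < r·a`,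
derives `ValiantsHypothesis` from (W_r) a real family `Θ` with `IsVNPFamily (Θ ⊗ ℂ)` and, eventually in `n`,
`2^(r·(n⌊log₂n⌋)) ≤ #zeros(Θₙ(X^(dₙ))) + 1`, together with (M_{a,b}) the ratio bound for infinitely many `K` at sizes
`m ≤ 2^(c·(⌊log₂K⌋+1)²)` (transfer `Census.pencilTransfer_logSq`).  Reading: by Descartes (tree
`Census.matrixDescartesRatio_subpowerSector`) (M_{a,b}) is FREE below `m ≈ K^(1+b/a)/12`; with `b/a` close to `r`
the crux is therefore consumed only at sizes `m ≳ K^(1+r−ε)` — so IF rate-`r` witnesses exist for every `r` (digits in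
base `n^r` in Tavenas' construction; not in the tree for `r ≥ 2`), the route needs `MatrixDescartes`-type bounds only
at sizes beyond every fixed power of `K`, i.e. exactly in the genuinely quasi-polynomial range up to `2^(c·log₂²K)`.
For `r = 1` (witness = the tree's `thetaWitness_proof`) the statement is exactly the landed
`Census.valiant_of_matrixDescartesRatio_logSq_io` (not restated here).  Nothing here bears on `DoorA26`/`DoorA34` or any numeral;
no new `Prop` is registered (both hypotheses are stated inline).

[folklore] The arithmetic of `closes` with the witness exponent `r` carried along.
-/

-- `Summit.ValiantsHypothesis.ValiantsHypothesis.…` repeats a component by the D-0017 layout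
-- (single-conjunct summit), which the `dupNamespace` linter flags; the name is mandated.
set_option linter.dupNamespace false

noncomputable section

namespace Summit.ValiantsHypothesis.ValiantsHypothesis.Theorems.LacunarySymmetroidMatrixDescartes.Census

open Literature.Computability.AlgebraicComplexity
open scoped BigOperators

/-- **Witness rate `r` versus saving `b/a < r`.**  See the module docstring.  Both hypotheses are OPEN for `r ≥ 2`
(the witness) and for all `b < r·a` (the bound); for `r = 1` the witness is the tree's `thetaWitness_proof`. [folklore] -/
theorem valiant_of_witnessRate_ratio_logSq_io (r a b : ℕ) (hr : 0 < r) (hab : b < r * a)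
    (hW : ∃ (Θ : ∀ n : ℕ, MvPolynomial (Fin n) ℝ) (d : ∀ n : ℕ, Fin n → ℕ),
      IsVNPFamily (fun n => MvPolynomial.map (algebraMap ℝ ℂ) (Θ n)) ∧
      ∃ n₀ : ℕ, ∀ n : ℕ, n₀ ≤ n → 2 ^ (r * (n * Nat.log 2 n)) ≤
        (MvPolynomial.aeval (fun i => (Polynomial.X : Polynomial ℝ) ^ d n i) (Θ n)).roots.toFinset.card + 1)
    (h : ∀ c K₁ : ℕ, ∃ K : ℕ, K₁ ≤ K ∧ ∀ m : ℕ, m ≤ 2 ^ (c * (Nat.log 2 K + 1) ^ 2) →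
      ∀ (d : Fin K → ℕ) (S : Fin K → Matrix (Fin m) (Fin m) ℝ), (∀ l, (S l).IsSymm) →
        (Matrix.det (∑ l, ((Polynomial.X : Polynomial ℝ) ^ d l) • (S l).map Polynomial.C)).roots.toFinset.card ^ a
          ≤ 2 ^ (b * (K * Nat.log 2 K))) :
    _root_.ValiantsHypothesis := by
  show Literature.Computability.AlgebraicComplexity.VP ℂ ≠ Literature.Computability.AlgebraicComplexity.VNP ℂ
  intro hEq
  obtain ⟨Θ, d, hVNP, n₀, hroots⟩ := hW
  have hVP : Literature.Computability.AlgebraicComplexity.IsVPFamily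
      (fun n => MvPolynomial.map (algebraMap ℝ ℂ) (Θ n)) := by
    have hmem := (Literature.Computability.AlgebraicComplexity.mem_VNP_ofFintype_iff_holds _).2 hVNP
    rw [← hEq] at hmem
    exact (Literature.Computability.AlgebraicComplexity.mem_VP_ofFintype_iff_holds _).1 hmem
  obtain ⟨c, hc⟩ := pencilTransfer_logSq (fun n => n) Θ hVP d
  obtain ⟨N, hN⟩ : ∃ N : ℕ, 2 ^ (2 * b + 1) = N := ⟨_, rfl⟩
  obtain ⟨K, hK₁, hK⟩ := h c (n₀ + N + a + b + 3)
  obtain ⟨n, rfl⟩ : ∃ n, K = n + 1 := ⟨K - 1, by omega⟩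
  have hn₀ : n₀ ≤ n := by omega
  have hnB : 2 ^ (2 * b + 1) ≤ n := by rw [hN]; omega
  have hnA : a + b + 2 ≤ n := by omega
  obtain ⟨m, hm, S, hS, hroot⟩ := hc n
  set Z := (MvPolynomial.aeval (fun i => (Polynomial.X : Polynomial ℝ) ^ d n i) (Θ n)).roots.toFinset.card
    with hZ
  have hm' : m ≤ 2 ^ (c * (Nat.log 2 (n + 1) + 1) ^ 2) :=
    hm.trans (Nat.pow_le_pow_right (by norm_num) (Nat.mul_le_mul_left _
      (Nat.pow_le_pow_left (Nat.add_le_add_right (Nat.log_mono_right (Nat.le_succ n)) 1) 2)))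
  have h1 := hK m hm' (Fin.cons (α := fun _ => ℕ) (0 : ℕ) (d n)) S hS
  rw [hroot] at h1
  have h2 : 2 ^ (r * (n * Nat.log 2 n)) ≤ Z + 1 := hroots n hn₀
  set L := Nat.log 2 n with hL
  have hL2 : 2 * b + 1 ≤ L := by
    rw [hL]
    exact Nat.le_log_of_pow_le one_lt_two hnB
  have hLn : L ≤ n := by rw [hL]; exact Nat.log_le_self 2 n
  have hL' : Nat.log 2 (n + 1) ≤ L + 1 := by
    rw [hL]
    calc Nat.log 2 (n + 1) ≤ Nat.log 2 (n * 2) := Nat.log_mono_right (by omega)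
      _ = Nat.log 2 n + 1 := Nat.log_mul_base (by norm_num) (by omega)
  have h3 : Z ^ a ≤ 2 ^ (b * ((n + 1) * (L + 1))) :=
    h1.trans (Nat.pow_le_pow_right (by norm_num) (Nat.mul_le_mul_left _ (Nat.mul_le_mul_left _ hL')))
  have hnL : 1 ≤ n * L := by nlinarith
  have hrW : 1 ≤ r * (n * L) := by nlinarith
  have h4 : 2 ^ (r * (n * L) - 1) ≤ Z := by
    have e : 2 ^ (r * (n * L)) = 2 * 2 ^ (r * (n * L) - 1) := by
      rw [← Nat.pow_succ']
      congr 1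
      omega
    have h2' := h2
    rw [e] at h2'
    have : 1 ≤ 2 ^ (r * (n * L) - 1) := Nat.one_le_two_pow
    omega
  have h5 : 2 ^ (a * (r * (n * L) - 1)) ≤ Z ^ a := by
    rw [pow_mul']
    exact Nat.pow_le_pow_left h4 a
  have h6 : a * (r * (n * L) - 1) ≤ b * ((n + 1) * (L + 1)) :=
    (Nat.pow_le_pow_iff_right (by norm_num)).1 (h5.trans h3)
  -- arithmetic: W := nL, P := rW − 1; aP ≤ bW + bn + bL + b, (b+1)W ≤ arW = a(P+1), W ≥ (2b+1)n, bL ≤ bn, n ≥ a+b+2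
  have i1 : (b + 1) * (n * L) ≤ r * a * (n * L) := Nat.mul_le_mul_right _ hab
  have i2 : n * (2 * b + 1) ≤ n * L := Nat.mul_le_mul_left n hL2
  have i3 : b * L ≤ b * n := Nat.mul_le_mul_left b hLn
  have e1 : (b + 1) * (n * L) = b * (n * L) + n * L := by ring
  have e2 : n * (2 * b + 1) = 2 * (b * n) + n := by ring
  have e3 : b * ((n + 1) * (L + 1)) = b * (n * L) + b * n + b * L + b := by ring
  have e4 : r * a * (n * L) = a * (r * (n * L) - 1) + a := by
    zify [hrW]
    ring
  rw [e1, e4] at i1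
  rw [e2] at i2
  rw [e3] at h6
  generalize hP : r * (n * L) - 1 = P at i1 h6
  generalize hQ : a * P = Q at i1 h6
  generalize hbW : b * (n * L) = U at i1 h6
  generalize hbn : b * n = V at i2 i3 h6
  generalize hbL : b * L = V' at i3 h6
  generalize hW' : n * L = W at i1 i2
  omega

end Summit.ValiantsHypothesis.ValiantsHypothesis.Theorems.LacunarySymmetroidMatrixDescartes.Census

end
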